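import Literature.IUT.LogThetaLattice.HolomorphicHull
import Literature.IUT.LogVolume.WildCubicUnitLog
import Literature.IUT.LogVolume.WildCubicUnitLogUnit
import Literature.AlgebraicGeometry.Frobenioids.Categories
import Literature.AnabelianGeometry.AbsoluteAnabelian.MLFSlimKummerProofs
import HarnessLib

/-!
# [IUTchIII] Remark 3.9.5 (vii) (Ob1) and (x): two GENUINE local-field clauses PROVED
# (proof-only companion of `HolomorphicHull.lean`; abc-iut cell, layer L6, slice [IUTchIII] §3)

S. Mochizuki, *Inter-universal Teichmüller theory III*, kurims manuscript (May 2020), §3, Remark 3.9.5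
[claim: Mochizuki2012, status: disputed].  Two printed clauses of (vii) and (x) are statements about genuine
`p`-adic local fields; this file gives each a kernel object over the tree's REAL objects (no definitions):

* **(vii) (Ob1), p. 131 l.27–35**: "`𝓘_k ⊆ k` can only be defined by using the ring structure of `𝒪_k` and is
  not, in general, stabilized by the natural action [via multiplication] by `𝒪^×_k`.  That is to say,
  `𝒪^{mdl}_k` only admits a 'canonical generator' up to an indeterminacy given by multiplication by `𝒪^×_k`,
  i.e., an indeterminacy that does not stabilize `𝓘_k`."  KERNEL WITNESS at the wildly ramified cubic field
  `K = ℚ₃(π)`, `π³ = 3` (campaign-S `WildCubicUnitLog*.lean`: `log₃(𝒪_K^×) ⊆ ψ⁻¹(3ℤ₃)` for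
  `ψ(a + bπ + cπ²) = a − b`, and `‖log₃(1+π)‖ = 1`): the pre-log-shell `log₃(𝒪_K^×)` (`logUnits K`,
  abc-iut-S1 `LocalUnitLog.lean`; the log-shell `𝓘_K = (2p)^{-1}·log_p(𝒪_K^×)` of [IUTchIII] Def. 1.1 (i)
  is a nonzero scalar multiple) does NOT contain `1` (`WildCubic.one_not_mem_logUnits`), although it contains
  the UNIT `z = log₃(1+π)`; hence the unit `z^{-1}` carries `z ∈ log₃(𝒪_K^×)` to `1 ∉ log₃(𝒪_K^×)`:
  `log₃(𝒪_K^×)` — and every nonzero scalar multiple of it, in particular `𝓘_K` — is NOT stable under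
  multiplication by `𝒪_K^×` (`WildCubic.logUnits_not_unit_stable`, `WildCubic.smul_logUnits_not_unit_stable`).
  (At absolute ramification `e ≤ p − 2` one has `log_p(𝒪_K^×) = 𝔪_K`, which IS `𝒪_K^×`-stable — the
  printed "in general" is sharp; cf. `LogUnitsHullDefect.lean`.)
* **(x), p. 145 l.8–16**: "if we write `G_{p_v} ⊆ Gal(F̄/ℚ)` for the unique decomposition group of `p_v` that
  contains `G_v`, then one verifies immediately that the fact that `G_{p_v}` does not admit a splitting
  `G_{p_v} ⥲ G_v × (G_{p_v}/G_v)` implies that this sort of norm operation … cannot be extended … to any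
  sort of [`G_v`-equivariant] operation".  The group-theoretic INPUT "`G_{p_v}` does not admit a splitting" is
  PROVED from slimness ([AbsAnab] Thm. 1.1.1 (ii), the tree's `galoisMLF_slim_holds`, abc-iut-L4-d2): in a
  slim topological group an element commuting with an open subgroup is trivial, so an isomorphism
  `G ≃* A × B` carrying an OPEN subgroup onto `A × {1}` forces `B = {1}`
  (`subsingleton_of_isSlimGroup_mulEquiv_prod`); hence the absolute Galois group of ANY `p`-adic local
  field `k` (here `k = ℚ_{p_v}`, `G_k = G_{p_v}`) admits NO direct-product splitting over a PROPER open
  subgroup (here `G_v = G_{K_v}`, `K_v ≠ ℚ_{p_v}`): `remark395x_no_prod_splitting`.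

Nothing here bears on the disputed [IUTchIII] Cor. 3.12 or takes a side (both items are classical local
algebra / profinite group theory quoted by the remark); typed ≠ discharged; covered ≠ endorsed.  Deliberately
NOT here: the "norm operation" consequence of (x) itself (interpretive), (vii) (Ob3)–(Ob9) (edges to
[FrdI] Prop. 2.1 (i) `PreFrobenioid.naiveFrobenius`, Prop. 3.9 (iii), Rmk. 3.9.4, Thm. 1.5).
-/

noncomputable section

namespace Literature.IUT.LogThetaLattice

universe u

/-! ### (x): a slim group admits no direct-product splitting over a proper open subgroup -/

section NoSplitting

open Literature.AlgebraicGeometry.Frobenioids (IsSlimGroup)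
open Literature.AnabelianGeometry.AbsoluteAnabelian (galoisMLF_slim galoisMLF_slim_holds)

/-- In a slim topological group ([FrdI] §0: centralisers of open subgroups are trivial) an element
commuting with every element of an open subgroup is `1` — PROVED (private helper). [folklore] -/
private theorem eq_one_of_isSlimGroup_of_forall_comm {G : Type u} [Group G] [TopologicalSpace G]
    (hG : IsSlimGroup G) (H : Subgroup G) (hH : IsOpen (H : Set G)) {g : G}
    (hg : ∀ h ∈ H, h * g = g * h) : g = 1 := by
  have hmem : g ∈ Subgroup.centralizer (H : Set G) := by
    rw [Subgroup.mem_centralizer_iff]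
    exact fun h hh => hg h hh
  rw [hG.centralizer_eq_bot H hH] at hmem
  exact Subgroup.mem_bot.mp hmem

/-- **No direct-product splitting of a slim group over an open subgroup.**  If `G` is slim and
`e : G ≃* A × B` is a group isomorphism such that the subgroup `e⁻¹(A × {1})` is OPEN in `G`, then `B` is
trivial: every `(1, b)` commutes with `A × {1}`, so `e⁻¹(1, b)` centralises an open subgroup — PROVED;
this is the abstract form of [IUTchIII] Rmk. 3.9.5 (x) p. 145 "`G_{p_v}` does not admit a splitting
`G_{p_v} ⥲ G_v × (G_{p_v}/G_v)`" (slimness being the only input). [claim: Mochizuki2012, status: disputed] -/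
theorem subsingleton_of_isSlimGroup_mulEquiv_prod {G : Type u} [Group G] [TopologicalSpace G]
    {A B : Type*} [Group A] [Group B] (hG : IsSlimGroup G) (e : G ≃* A × B)
    (hopen : IsOpen ((((⊤ : Subgroup A).prod (⊥ : Subgroup B)).comap e.toMonoidHom : Subgroup G) :
      Set G)) : Subsingleton B := by
  refine ⟨fun b₁ b₂ => ?_⟩
  suffices key : ∀ b : B, b = 1 by rw [key b₁, key b₂]
  intro b
  have h1 : e.symm (1, b) = 1 := by
    refine eq_one_of_isSlimGroup_of_forall_comm hG _ hopen fun h hh => ?_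
    have h2 : (e h).2 = 1 := by
      have hh' := Subgroup.mem_comap.mp hh
      exact Subgroup.mem_bot.mp (Subgroup.mem_prod.mp hh').2
    apply e.injective
    rw [map_mul, map_mul, e.apply_symm_apply]
    exact Prod.ext (by simp) (by simp [h2])
  have h3 : ((1 : A), b) = 1 := by
    have := congrArg e h1
    rwa [e.apply_symm_apply, map_one] at this
  simpa using congrArg Prod.snd h3

/-- Hence a slim group with an isomorphism `e : G ≃* A × B` whose `e⁻¹(A × {1})` is open has
`e⁻¹(A × {1}) = G`: the splitting is over the IMPROPER subgroup only — PROVED (abstract form of [IUTchIII]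
Rmk. 3.9.5 (x) p. 145, "does not admit a splitting"). [claim: Mochizuki2012, status: disputed] -/
theorem comap_prod_eq_top_of_isSlimGroup {G : Type u} [Group G] [TopologicalSpace G]
    {A B : Type*} [Group A] [Group B] (hG : IsSlimGroup G) (e : G ≃* A × B)
    (hopen : IsOpen ((((⊤ : Subgroup A).prod (⊥ : Subgroup B)).comap e.toMonoidHom : Subgroup G) :
      Set G)) :
    ((⊤ : Subgroup A).prod (⊥ : Subgroup B)).comap e.toMonoidHom = ⊤ := by
  haveI : Subsingleton B := subsingleton_of_isSlimGroup_mulEquiv_prod hG e hopen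
  rw [eq_top_iff]
  intro g _
  rw [Subgroup.mem_comap, Subgroup.mem_prod]
  exact ⟨Subgroup.mem_top _, Subgroup.mem_bot.mpr (Subsingleton.elim _ _)⟩

/-- **IUTchIII:Rmk3.9.5(x)** p. 145 l.8–13, the group-theoretic input "the fact that `G_{p_v}` does not admit a
splitting `G_{p_v} ⥲ G_v × (G_{p_v}/G_v)`" — PROVED for the absolute Galois group `G_k` of ANY finite
extension `k` of `ℚ_p` (print: `k = ℚ_{p_v}`, `G_k = G_{p_v}` the decomposition group) and ANY proper open
subgroup in the rôle of `G_v` (print: `G_v = G_{K_v} ⊊ G_{p_v}`, i.e. `K_v ≠ ℚ_{p_v}`): there is NO group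
isomorphism `e : G_k ≃* A × B` under which that subgroup is `e⁻¹(A × {1})`.  Input: slimness of `G_k`,
[AbsAnab] Thm. 1.1.1 (ii), DISCHARGED in the tree (`galoisMLF_slim_holds`).
[claim: Mochizuki2012, status: disputed] -/
theorem remark395x_no_prod_splitting (p : ℕ) [Fact p.Prime] (k : Type) [Field k] [Algebra ℚ_[p] k]
    [FiniteDimensional ℚ_[p] k] {A B : Type*} [Group A] [Group B]
    (e : Field.absoluteGaloisGroup k ≃* A × B)
    (hopen : IsOpen ((((⊤ : Subgroup A).prod (⊥ : Subgroup B)).comap e.toMonoidHom :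
      Subgroup (Field.absoluteGaloisGroup k)) : Set (Field.absoluteGaloisGroup k)))
    (hproper : ((⊤ : Subgroup A).prod (⊥ : Subgroup B)).comap e.toMonoidHom ≠ ⊤) : False :=
  hproper (comap_prod_eq_top_of_isSlimGroup (galoisMLF_slim_holds p k) e hopen)

/-- The same, read as: for `G_k` slim, any direct-product decomposition `G_k ≃* A × B` with `e⁻¹(A × {1})`
open has a TRIVIAL second factor — PROVED. [claim: Mochizuki2012, status: disputed] -/
theorem remark395x_prod_factor_subsingleton (p : ℕ) [Fact p.Prime] (k : Type) [Field k] [Algebra ℚ_[p] k]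
    [FiniteDimensional ℚ_[p] k] {A B : Type*} [Group A] [Group B]
    (e : Field.absoluteGaloisGroup k ≃* A × B)
    (hopen : IsOpen ((((⊤ : Subgroup A).prod (⊥ : Subgroup B)).comap e.toMonoidHom :
      Subgroup (Field.absoluteGaloisGroup k)) : Set (Field.absoluteGaloisGroup k))) :
    Subsingleton B :=
  subsingleton_of_isSlimGroup_mulEquiv_prod (galoisMLF_slim_holds p k) e hopen

end NoSplitting

end Literature.IUT.LogThetaLattice

/-! ### (vii) (Ob1): the (pre-)log-shell is not `𝒪^×`-stable at the wild cubic field `ℚ₃(∛3)` -/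

namespace Literature.IUT.LogVolume

namespace WildCubic

open Metric Set
open scoped Pointwise

variable {K : Type*} [NontriviallyNormedField K] [NormedAlgebra ℚ_[3] K] [IsUltrametricDist K]
  [ProperSpace K] {π : K} (B : Module.Basis (Fin 3) ℚ_[3] K)

/-- At `K = ℚ₃(π)`, `π³ = 3`: **`1 ∉ log₃(𝒪_K^×)`** — every `z ∈ log₃(𝒪_K^×)` has `‖ψ(z)‖ ≤ 1/3`
(`norm_psi_le_of_mem_logUnits`), but `ψ(1) = 1`.  ([IUTchIII] Rmk. 3.9.5 (vii) (Ob1) p. 131: `𝒪^{mdl}_k` has no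
canonical generator inside `𝓘_k`.) [claim: Mochizuki2012, status: disputed] -/
theorem one_not_mem_logUnits (hπ : π ^ 3 = 3) (hB0 : B 0 = 1) (hB1 : B 1 = π) (hB2 : B 2 = π ^ 2) :
    (1 : K) ∉ logUnits K := by
  intro h
  have hle := norm_psi_le_of_mem_logUnits B hπ hB0 hB1 hB2 h
  rw [psi_one B hB0, norm_one] at hle
  norm_num at hle

/-- **IUTchIII:Rmk3.9.5(vii) (Ob1)** p. 131 l.27–35 — "`𝓘_k` … is not, in general, stabilized by the natural action
[via multiplication] by `𝒪^×_k`": KERNEL WITNESS at the wild cubic field `K = ℚ₃(π)`, `π³ = 3`: the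
pre-log-shell `log₃(𝒪_K^×)` (`logUnits K`) is NOT stable under multiplication by units — the unit
`z = log₃(1+π)` (`‖z‖ = 1`, `norm_unitLog_one_add_pi_eq_one`) lies in it, and the unit `z^{-1}` carries it
to `1 ∉ log₃(𝒪_K^×)` — PROVED. [claim: Mochizuki2012, status: disputed] -/
theorem logUnits_not_unit_stable (hπ : π ^ 3 = 3) (hB0 : B 0 = 1) (hB1 : B 1 = π) (hB2 : B 2 = π ^ 2) :
    ¬ ∀ u z : K, ‖u‖ = 1 → z ∈ logUnits K → u * z ∈ logUnits K := by
  intro hstab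
  set z : K := unitLog (1 + π) with hz
  have hz1 : ‖z‖ = 1 := norm_unitLog_one_add_pi_eq_one hπ
  have hz0 : z ≠ 0 := norm_pos_iff.mp (by rw [hz1]; norm_num)
  have hzmem : z ∈ logUnits K := unitLog_mem_logUnits (norm_one_add_pi hπ)
  have hinv : ‖z⁻¹‖ = 1 := by rw [norm_inv, hz1, inv_one]
  have h1 : (1 : K) ∈ logUnits K := by
    have := hstab z⁻¹ z hinv hzmem
    rwa [inv_mul_cancel₀ hz0] at this
  exact one_not_mem_logUnits B hπ hB0 hB1 hB2 h1

/-- An explicit offending pair for (Ob1): the units `u = (log₃(1+π))^{-1}` and `z = log₃(1+π) ∈ log₃(𝒪_K^×)`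
with `u·z = 1 ∉ log₃(𝒪_K^×)` — PROVED. [claim: Mochizuki2012, status: disputed] -/
theorem exists_unit_mul_not_mem_logUnits (hπ : π ^ 3 = 3) (hB0 : B 0 = 1) (hB1 : B 1 = π)
    (hB2 : B 2 = π ^ 2) :
    ∃ u z : K, ‖u‖ = 1 ∧ z ∈ logUnits K ∧ u * z ∉ logUnits K := by
  by_contra h
  push Not at h
  exact logUnits_not_unit_stable B hπ hB0 hB1 hB2 fun u z hu hz => h u z hu hz

/-- **(Ob1) for the log-shell itself**: for every nonzero scalar `c` (print: `c = (2p)^{-1}`, [IUTchIII]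
Def. 1.1 (i): `𝓘_k = (2p)^{-1}·log_p(𝒪^×_k)`), the scaled shell `c·log₃(𝒪_K^×)` is likewise NOT stable under
multiplication by `𝒪_K^×` at `K = ℚ₃(∛3)` — PROVED. [claim: Mochizuki2012, status: disputed] -/
theorem smul_logUnits_not_unit_stable (hπ : π ^ 3 = 3) (hB0 : B 0 = 1) (hB1 : B 1 = π)
    (hB2 : B 2 = π ^ 2) {c : K} (hc : c ≠ 0) :
    ¬ ∀ u z : K, ‖u‖ = 1 → z ∈ c • logUnits K → u * z ∈ c • logUnits K := by
  intro hstab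
  apply logUnits_not_unit_stable B hπ hB0 hB1 hB2
  intro u z hu hz
  have hcz : c • z ∈ c • logUnits K := Set.smul_mem_smul_set hz
  have h := hstab u (c • z) hu hcz
  rw [smul_eq_mul, mul_left_comm, ← smul_eq_mul] at h
  exact (Set.smul_mem_smul_set_iff₀ hc _ _).mp h

end WildCubic

end Literature.IUT.LogVolume
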